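import Literature.MathematicalPhysics.QuantumLattice.StrongExpDecaySlabCubes
import HarnessLib

/-!
# Cubes in a slab, II: the windows around a link and the exhaustion of the slab
# (Chatterjee, CMP 385 (2021), §§9–11; inputs of Dobrushin–Shlosman's window comparison)

Continuation of `StrongExpDecaySlabCubes.lean` (same window system: to every interior link `c` of the slab
`{0 ≤ x₀ ≤ n}` the interior `win c` of the cube `b(c) + {0,…,n}^d`, `b(c) = (0, c₁ − 1, …, c_{d−1} − 1)`, and
`win c = ∅` for every other link). This file provides the remaining combinatorial hypotheses of
`DobrushinShlosman.measure_eq_of_frozen_dlr_window_bulk` for it: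

* `mem_cover_iff` — the finite set `cover x` of centres whose window contains `x` (candidate centres `c₀ ∈ [0,n]`,
  `c_j ∈ [x_j + 1 − n, x_j + 1]`, filtered);
* `le_card_cover` — **an interior slab link lies in at least `(n−1)^d` windows** (Chatterjee 2021, proof of
  Lemma 11.1: «it is easy to see that `|𝔅(e)| > C N^{d−1}`»; here with the multiplicity of the centres);
* `exists_slab_exhaustion_profile` — the exhaustion of the free region (interior slab links) by the finite volumes
  `Λ_L = {interior slab links with spatial coordinates in [−L, L]}` together with the profile
  `ℓ(x) = ⌊(L − ‖x‖_{∞,spatial}) / (n+2)⌋`: windows around links of positive profile lie in `Λ_L` with their cubes,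
  which leave `Λ_L` only through the frozen temporal faces; `ℓ` moves by at most one between a link and a link of a
  common cube; `ℓ ≥ L₀` on any prescribed finite set for `L` large (Chatterjee 2021 §12: «if we let `M → ∞` …
  for any boundary condition on the infinite slab there is a unique Gibbs measure»).

Pure lattice combinatorics; link sets as explicit `Finset` formulas, no definitions.

## References
* S. Chatterjee, CMP 385 (2021), arXiv:2006.16229: §9 (the slab `S_{M,N}` and its cubes), proof of Lemma 11.1,
  §12 (first paragraph).
* R. L. Dobrushin, S. B. Shlosman (1985), Thm. 1.
-/

noncomputable section

open Finset Function

namespace Literature.MathematicalPhysics.QuantumLattice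

section SlabCover

variable {d : ℕ}

/-- Membership in the interior link set of a cube, unfolded. [folklore] -/
private theorem mem_cubeInterior_iff' {v : Fin d → ℤ} {n : ℕ} {Λ : Finset (ZdEdge d)}
    (hΛ : Λ = (((Fintype.piFinset fun j : Fin d => Finset.Icc (v j) (v j + n)) ×ˢ
        (Finset.univ : Finset (Fin d))).filter fun e =>
          e.1 e.2 + 1 ≤ v e.2 + n ∧ ∀ j, j ≠ e.2 → v j < e.1 j ∧ e.1 j < v j + n))
    (u : ZdEdge d) :
    u ∈ Λ ↔ (∀ j, v j ≤ u.1 j ∧ u.1 j ≤ v j + n) ∧ u.1 u.2 + 1 ≤ v u.2 + n ∧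
      ∀ j, j ≠ u.2 → v j < u.1 j ∧ u.1 j < v j + n := by
  classical
  rw [hΛ]
  simp only [Finset.mem_filter, Finset.mem_product, Fintype.mem_piFinset, Finset.mem_Icc,
    Finset.mem_univ, and_true]

/-- Membership in the link set of a cube, unfolded. [folklore] -/
private theorem mem_cubeEdges_iff' {v : Fin d → ℤ} {n : ℕ} {E : Finset (ZdEdge d)}
    (hE : E = (((Fintype.piFinset fun j : Fin d => Finset.Icc (v j) (v j + n)) ×ˢ
        (Finset.univ : Finset (Fin d))).filter fun e => e.1 e.2 + 1 ≤ v e.2 + n))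
    (u : ZdEdge d) :
    u ∈ E ↔ (∀ j, v j ≤ u.1 j ∧ u.1 j ≤ v j + n) ∧ u.1 u.2 + 1 ≤ v u.2 + n := by
  classical
  rw [hE]
  simp only [Finset.mem_filter, Finset.mem_product, Fintype.mem_piFinset, Finset.mem_Icc,
    Finset.mem_univ, and_true]

/-! ### §1 The centres whose window contains a given link -/

/-- **The windows containing a link**: with `win c` the interior of the cube `b(c) + {0,…,n}^d` for interior slab
links `c` and `∅` otherwise, `x ∈ win c` iff `c` belongs to the finite set `cover x` of candidate centres
(`c₀ ∈ [0, n]`, `c_j ∈ [x_j + 1 − n, x_j + 1]` for `j ≠ 0`) that are interior slab links with `x ∈ win c`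
(Chatterjee 2021 §10, the set `𝔅(e)` of cubes through `e`). [cite: Chatterjee2021, §10] -/
theorem mem_cover_iff [NeZero d] (n : ℕ) (win cover : ZdEdge d → Finset (ZdEdge d))
    (hwin : ∀ c, win c = if IsSlabInteriorEdge n c then (((Fintype.piFinset fun j : Fin d =>
        Finset.Icc ((fun j : Fin d => if j = 0 then (0 : ℤ) else c.1 j - 1) j)
          ((fun j : Fin d => if j = 0 then (0 : ℤ) else c.1 j - 1) j + n)) ×ˢ
        (Finset.univ : Finset (Fin d))).filter fun e =>
          e.1 e.2 + 1 ≤ (fun j : Fin d => if j = 0 then (0 : ℤ) else c.1 j - 1) e.2 + n ∧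
          ∀ j, j ≠ e.2 → (fun j : Fin d => if j = 0 then (0 : ℤ) else c.1 j - 1) j < e.1 j ∧
            e.1 j < (fun j : Fin d => if j = 0 then (0 : ℤ) else c.1 j - 1) j + n) else ∅)
    (hcover : ∀ x, cover x = ((Fintype.piFinset fun j : Fin d =>
      if j = 0 then Finset.Icc (0 : ℤ) n else Finset.Icc (x.1 j + 1 - n) (x.1 j + 1)) ×ˢ
        (Finset.univ : Finset (Fin d))).filter fun c => IsSlabInteriorEdge n c ∧ x ∈ win c)
    (c x : ZdEdge d) : x ∈ win c ↔ c ∈ cover x := by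
  classical
  rw [hcover]
  simp only [Finset.mem_filter, Finset.mem_product, Fintype.mem_piFinset, Finset.mem_univ, and_true]
  constructor
  · intro hx
    by_cases hc : IsSlabInteriorEdge n c
    · refine ⟨fun j => ?_, hc, hx⟩
      rw [hwin c, if_pos hc] at hx
      obtain ⟨h1, -, -⟩ := (mem_cubeInterior_iff' rfl x).1 hx
      by_cases hj0 : j = 0
      · subst hj0
        simp only [if_true, Finset.mem_Icc]
        rcases hc with ⟨-, h0, h0'⟩ | ⟨-, h0, h0'⟩ <;> constructor <;> omega
      · simp only [if_neg hj0, Finset.mem_Icc]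
        have := h1 j
        simp only [if_neg hj0] at this
        constructor <;> omega
    · rw [hwin c, if_neg hc] at hx
      exact absurd hx (Finset.notMem_empty x)
  · rintro ⟨-, -, hx⟩
    exact hx

/-- **An interior slab link lies in at least `(n−1)^d` windows** (Chatterjee 2021, proof of Lemma 11.1:
«`|𝔅(e)| > C N^{d−1}`»; counted here with the multiplicity of the centres): for `n ≥ 2` and an interior link `x`
of the slab, the time-like centres `c = (z, 0)` with `z₀ ∈ [0, n−2]` and `z_j ∈ [x_j + 2 − n, x_j]` (`j ≠ 0`) all
have `x` in their window. [cite: Chatterjee2021, §11 proof of Lemma 11.1] -/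
theorem le_card_cover [NeZero d] {n : ℕ} (hn : 2 ≤ n) (win cover : ZdEdge d → Finset (ZdEdge d))
    (hwin : ∀ c, win c = if IsSlabInteriorEdge n c then (((Fintype.piFinset fun j : Fin d =>
        Finset.Icc ((fun j : Fin d => if j = 0 then (0 : ℤ) else c.1 j - 1) j)
          ((fun j : Fin d => if j = 0 then (0 : ℤ) else c.1 j - 1) j + n)) ×ˢ
        (Finset.univ : Finset (Fin d))).filter fun e =>
          e.1 e.2 + 1 ≤ (fun j : Fin d => if j = 0 then (0 : ℤ) else c.1 j - 1) e.2 + n ∧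
          ∀ j, j ≠ e.2 → (fun j : Fin d => if j = 0 then (0 : ℤ) else c.1 j - 1) j < e.1 j ∧
            e.1 j < (fun j : Fin d => if j = 0 then (0 : ℤ) else c.1 j - 1) j + n) else ∅)
    (hcover : ∀ x, cover x = ((Fintype.piFinset fun j : Fin d =>
      if j = 0 then Finset.Icc (0 : ℤ) n else Finset.Icc (x.1 j + 1 - n) (x.1 j + 1)) ×ˢ
        (Finset.univ : Finset (Fin d))).filter fun c => IsSlabInteriorEdge n c ∧ x ∈ win c)
    {x : ZdEdge d} (hx : IsSlabInteriorEdge n x) : (n - 1) ^ d ≤ (cover x).card := by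
  classical
  set S : Finset (Fin d → ℤ) := Fintype.piFinset fun j : Fin d =>
    if j = 0 then Finset.Icc (0 : ℤ) ((n : ℤ) - 2) else Finset.Icc (x.1 j + 2 - n) (x.1 j) with hS
  have hn' : (2 : ℤ) ≤ n := by exact_mod_cast hn
  -- the candidate time-like centres have `x` in their window
  have hmem : ∀ z ∈ S, ((z, (0 : Fin d)) : ZdEdge d) ∈ cover x := by
    intro z hz
    rw [hS, Fintype.mem_piFinset] at hz
    have hz0 : 0 ≤ z 0 ∧ z 0 ≤ (n : ℤ) - 2 := by
      have := hz 0; simp only [if_true, Finset.mem_Icc] at this; exact this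
    have hzj : ∀ j, j ≠ 0 → x.1 j + 2 - n ≤ z j ∧ z j ≤ x.1 j := fun j hj => by
      have := hz j; simp only [if_neg hj, Finset.mem_Icc] at this; exact this
    have hcW : IsSlabInteriorEdge n ((z, (0 : Fin d)) : ZdEdge d) :=
      Or.inl ⟨rfl, hz0.1, by show z 0 + 1 ≤ (n : ℤ); omega⟩
    rw [← mem_cover_iff n win cover hwin hcover, hwin _, if_pos hcW]
    refine (mem_cubeInterior_iff' rfl x).2 ?_
    dsimp only
    refine ⟨fun j => ?_, ?_, fun j hj => ?_⟩
    · by_cases hj0 : j = 0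
      · subst hj0; simp only [if_true]
        rcases hx with ⟨-, h0, h0'⟩ | ⟨-, h0, h0'⟩ <;> constructor <;> omega
      · simp only [if_neg hj0]; have := hzj j hj0; constructor <;> omega
    · by_cases hx2 : x.2 = 0
      · rw [hx2]; simp only [if_true]
        rcases hx with ⟨-, -, h0'⟩ | ⟨h, -, -⟩
        · simpa using h0'
        · exact absurd hx2 h
      · simp only [if_neg hx2]; have := hzj x.2 hx2; omega
    · by_cases hj0 : j = 0
      · subst hj0; simp only [if_true]
        rcases hx with ⟨h, -, -⟩ | ⟨-, h0, h0'⟩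
        · exact absurd h.symm hj
        · exact ⟨h0, by simpa using h0'⟩
      · simp only [if_neg hj0]; have := hzj j hj0; constructor <;> omega
  -- their number
  have hcard : S.card = (n - 1) ^ d := by
    rw [hS, Fintype.card_piFinset]
    have hfac : ∀ j : Fin d, (if j = 0 then Finset.Icc (0 : ℤ) ((n : ℤ) - 2)
        else Finset.Icc (x.1 j + 2 - n) (x.1 j)).card = n - 1 := by
      intro j
      split_ifs
      · rw [Int.card_Icc]
        have e : (n : ℤ) - 2 + 1 - 0 = ((n - 1 : ℕ) : ℤ) := by omega
        rw [e, Int.toNat_natCast]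
      · rw [Int.card_Icc]
        have e : x.1 j + 1 - (x.1 j + 2 - n) = ((n - 1 : ℕ) : ℤ) := by omega
        rw [e, Int.toNat_natCast]
    rw [Finset.prod_congr rfl fun j _ => hfac j, Finset.prod_const, Finset.card_univ, Fintype.card_fin]
  rw [← hcard]
  refine Finset.card_le_card_of_injOn (fun z => ((z, (0 : Fin d)) : ZdEdge d)) (fun z hz => ?_) ?_
  · exact Finset.mem_coe.2 (hmem z (Finset.mem_coe.1 hz))
  · intro a _ b _ h
    exact (Prod.mk.inj h).1

/-! ### §2 The exhaustion of the interior slab links and its profile -/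

/-- Spatial sup-distance control between a link of a cube and an interior link of the same cube. [folklore] -/
private theorem natAbs_le_of_mem_cube [NeZero d] {n : ℕ} {c x e : ZdEdge d}
    (hx : ∀ j, (fun j : Fin d => if j = 0 then (0 : ℤ) else c.1 j - 1) j ≤ x.1 j ∧
      x.1 j ≤ (fun j : Fin d => if j = 0 then (0 : ℤ) else c.1 j - 1) j + n)
    (he : ∀ j, (fun j : Fin d => if j = 0 then (0 : ℤ) else c.1 j - 1) j ≤ e.1 j ∧
      e.1 j ≤ (fun j : Fin d => if j = 0 then (0 : ℤ) else c.1 j - 1) j + n)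
    {j : Fin d} (hj : j ≠ 0) : (e.1 j).natAbs ≤ (x.1 j).natAbs + n ∧ (x.1 j).natAbs ≤ (e.1 j).natAbs + n ∧
      (c.1 j).natAbs ≤ (x.1 j).natAbs + n + 1 := by
  have h1 := hx j
  have h2 := he j
  simp only [if_neg hj] at h1 h2
  refine ⟨?_, ?_, ?_⟩ <;> omega

/-- ★ **Exhaustion of the interior slab links adapted to the cube windows** (the exhaustion hypothesis of
`DobrushinShlosman.measure_eq_of_frozen_dlr_window_bulk`; Chatterjee 2021 §12, letting `M → ∞` in the finite slabs
`S_{M,N}`). Window system: `win c` = interior of the cube `b(c) + {0,…,n}^d` for interior slab links `c` (`n ≥ 1`),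
`∅` otherwise; `nbhd c` = the links of that cube, resp. `∅`; an array `K` supported in `x ∈ win c`,
`y ∈ nbhd c`. For every finite set `Δ` of interior slab links and every depth `L₀` there is a finite set `Λ` of
interior slab links, `Δ ⊆ Λ`, and a profile `ℓ` with: windows around links of positive profile have centre and
window in `Λ`, and their cubes leave `Λ` only through links that are NOT interior slab links (the frozen temporal
faces); `ℓ` drops by at most one from `x ∈ win c` to any `y ∈ nbhd c`; `ℓ ≥ L₀` on `Δ`. Construction:
`Λ = {interior slab links with spatial coordinates in [−L, L]}`, `ℓ(x) = ⌊(L − max_{j≠0} |x_j|)/(n+2)⌋`, `L` large.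
[cite: Chatterjee2021, §12] -/
theorem exists_slab_exhaustion_profile [NeZero d] {n : ℕ} (hn : 1 ≤ n)
    (win nbhd : ZdEdge d → Finset (ZdEdge d)) (K : ZdEdge d → ZdEdge d → ZdEdge d → ℝ)
    (hwin : ∀ c, win c = if IsSlabInteriorEdge n c then (((Fintype.piFinset fun j : Fin d =>
        Finset.Icc ((fun j : Fin d => if j = 0 then (0 : ℤ) else c.1 j - 1) j)
          ((fun j : Fin d => if j = 0 then (0 : ℤ) else c.1 j - 1) j + n)) ×ˢ
        (Finset.univ : Finset (Fin d))).filter fun e =>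
          e.1 e.2 + 1 ≤ (fun j : Fin d => if j = 0 then (0 : ℤ) else c.1 j - 1) e.2 + n ∧
          ∀ j, j ≠ e.2 → (fun j : Fin d => if j = 0 then (0 : ℤ) else c.1 j - 1) j < e.1 j ∧
            e.1 j < (fun j : Fin d => if j = 0 then (0 : ℤ) else c.1 j - 1) j + n) else ∅)
    (hnbhd : ∀ c, nbhd c = if IsSlabInteriorEdge n c then (((Fintype.piFinset fun j : Fin d =>
        Finset.Icc ((fun j : Fin d => if j = 0 then (0 : ℤ) else c.1 j - 1) j)
          ((fun j : Fin d => if j = 0 then (0 : ℤ) else c.1 j - 1) j + n)) ×ˢ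
        (Finset.univ : Finset (Fin d))).filter fun e =>
          e.1 e.2 + 1 ≤ (fun j : Fin d => if j = 0 then (0 : ℤ) else c.1 j - 1) e.2 + n) else ∅)
    (hK : ∀ c y x, K c y x ≠ 0 → x ∈ win c ∧ y ∈ nbhd c)
    (Δ : Finset (ZdEdge d)) (hΔ : (↑Δ : Set (ZdEdge d)) ⊆ {e | IsSlabInteriorEdge n e}) (L₀ : ℕ) :
    ∃ (Λ : Finset (ZdEdge d)) (ℓ : ZdEdge d → ℕ), Δ ⊆ Λ ∧
      (↑Λ : Set (ZdEdge d)) ⊆ {e | IsSlabInteriorEdge n e} ∧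
      (∀ x, ℓ x ≠ 0 → ∀ c, x ∈ win c → c ∈ Λ ∧ win c ⊆ Λ ∧
        ∀ v ∈ nbhd c, v ∉ Λ → v ∉ {e : ZdEdge d | IsSlabInteriorEdge n e}) ∧
      (∀ c x y, x ∈ win c → K c y x ≠ 0 → ℓ x ≤ ℓ y + 1) ∧ (∀ x ∈ Δ, L₀ ≤ ℓ x) := by
  classical
  -- the spatial sup norm (as a natural number)
  set Sp : ZdEdge d → ℕ := fun e => Finset.univ.sup fun j : Fin d => if j = 0 then 0 else (e.1 j).natAbs
    with hSp
  have hSp_le : ∀ (e : ZdEdge d) (m : ℕ), (∀ j, j ≠ 0 → (e.1 j).natAbs ≤ m) → Sp e ≤ m := by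
    intro e m h
    refine Finset.sup_le fun j _ => ?_
    by_cases hj : j = 0
    · simp [hj]
    · simp only [if_neg hj]; exact h j hj
  have hle_Sp : ∀ (e : ZdEdge d) (j : Fin d), j ≠ 0 → (e.1 j).natAbs ≤ Sp e := by
    intro e j hj
    have := Finset.le_sup (f := fun j : Fin d => if j = 0 then 0 else (e.1 j).natAbs) (Finset.mem_univ j)
    simp only [if_neg hj] at this
    exact this
  -- the scale `L`
  set SΔ : ℕ := Δ.sup Sp with hSΔ
  set L : ℕ := SΔ + (n + 2) * (L₀ + 1) + n + 2 with hL
  -- the volume and the profile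
  set Λ : Finset (ZdEdge d) := ((Fintype.piFinset fun j : Fin d =>
    if j = 0 then Finset.Icc (0 : ℤ) n else Finset.Icc (-(L : ℤ)) L) ×ˢ
      (Finset.univ : Finset (Fin d))).filter fun e => IsSlabInteriorEdge n e with hΛdef
  set ℓ : ZdEdge d → ℕ := fun e => (L - Sp e) / (n + 2) with hℓ
  have hmemΛ : ∀ e : ZdEdge d, e ∈ Λ ↔ IsSlabInteriorEdge n e ∧ Sp e ≤ L := by
    intro e
    rw [hΛdef, Finset.mem_filter, Finset.mem_product, Fintype.mem_piFinset]
    constructor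
    · rintro ⟨⟨h1, -⟩, h2⟩
      refine ⟨h2, hSp_le e L fun j hj => ?_⟩
      have := h1 j
      simp only [if_neg hj, Finset.mem_Icc] at this
      omega
    · rintro ⟨h2, h3⟩
      refine ⟨⟨fun j => ?_, Finset.mem_univ _⟩, h2⟩
      by_cases hj : j = 0
      · subst hj
        simp only [if_true, Finset.mem_Icc]
        rcases h2 with ⟨-, h0, h0'⟩ | ⟨-, h0, h0'⟩ <;> constructor <;> omega
      · simp only [if_neg hj, Finset.mem_Icc]
        have := hle_Sp e j hj
        constructor <;> omega
  -- geometry of a window: centre, interior links and cube links versus a link `x` of the window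
  have hgeom : ∀ c x, x ∈ win c → IsSlabInteriorEdge n c ∧ Sp c ≤ Sp x + n + 1 ∧
      (∀ e ∈ win c, IsSlabInteriorEdge n e ∧ Sp e ≤ Sp x + n) ∧
      (∀ e ∈ nbhd c, Sp e ≤ Sp x + n ∧ Sp x ≤ Sp e + n) := by
    intro c x hx
    by_cases hc : IsSlabInteriorEdge n c
    · rw [hwin c, if_pos hc] at hx
      have hx' := (mem_cubeInterior_iff' rfl x).1 hx
      refine ⟨hc, hSp_le c _ fun j hj => ?_, fun e he => ?_, fun e he => ?_⟩
      · exact ((natAbs_le_of_mem_cube (e := x) hx'.1 hx'.1 hj).2.2).trans (by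
          have := hle_Sp x j hj; omega)
      · rw [hwin c, if_pos hc] at he
        have he' := (mem_cubeInterior_iff' rfl e).1 he
        refine ⟨isSlabInteriorEdge_of_mem_cubeInterior (v := fun j : Fin d =>
          if j = 0 then (0 : ℤ) else c.1 j - 1) (by simp) rfl he, hSp_le e _ fun j hj => ?_⟩
        exact (natAbs_le_of_mem_cube hx'.1 he'.1 hj).1.trans (by have := hle_Sp x j hj; omega)
      · rw [hnbhd c, if_pos hc] at he
        have he' := (mem_cubeEdges_iff' rfl e).1 he
        refine ⟨hSp_le e _ fun j hj => ?_, hSp_le x _ fun j hj => ?_⟩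
        · exact (natAbs_le_of_mem_cube hx'.1 he'.1 hj).1.trans (by have := hle_Sp x j hj; omega)
        · exact (natAbs_le_of_mem_cube hx'.1 he'.1 hj).2.1.trans (by have := hle_Sp e j hj; omega)
    · rw [hwin c, if_neg hc] at hx
      exact absurd hx (Finset.notMem_empty x)
  refine ⟨Λ, ℓ, fun x hx => ?_, fun e he => ((hmemΛ e).1 (Finset.mem_coe.1 he)).1, ?_, ?_, ?_⟩
  · -- `Δ ⊆ Λ`
    have hSx : Sp x ≤ SΔ := Finset.le_sup (f := Sp) hx
    exact (hmemΛ x).2 ⟨hΔ (Finset.mem_coe.2 hx), by omega⟩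
  · -- windows around links of positive profile
    intro x hx c hxc
    obtain ⟨hc, hSc, hwinc, hnbhdc⟩ := hgeom c x hxc
    have hLx : Sp x + n + 2 ≤ L := by
      by_contra h
      apply hx
      simp only [hℓ]
      apply Nat.div_eq_of_lt
      omega
    refine ⟨(hmemΛ c).2 ⟨hc, by omega⟩, fun e he => (hmemΛ e).2 ⟨(hwinc e he).1, by
      have := (hwinc e he).2; omega⟩, fun v hv hvΛ hvW => hvΛ ((hmemΛ v).2 ⟨hvW, by
      have := (hnbhdc v hv).1; omega⟩)⟩
  · -- the profile moves by at most one inside a cube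
    intro c x y hxc hKc
    obtain ⟨-, hy⟩ := hK c y x hKc
    obtain ⟨-, -, -, hnbhdc⟩ := hgeom c x hxc
    have h := (hnbhdc y hy).1
    simp only [hℓ]
    have h1 : L - Sp x ≤ (L - Sp y) + (n + 2) := by omega
    calc (L - Sp x) / (n + 2) ≤ ((L - Sp y) + (n + 2)) / (n + 2) := Nat.div_le_div_right h1
      _ = (L - Sp y) / (n + 2) + 1 := Nat.add_div_right _ (by omega)
  · -- depth `≥ L₀` on `Δ`
    intro x hx
    have hSx : Sp x ≤ SΔ := Finset.le_sup (f := Sp) hx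
    simp only [hℓ]
    refine (Nat.le_div_iff_mul_le (by omega)).2 ?_
    have : L₀ * (n + 2) ≤ (n + 2) * (L₀ + 1) := by nlinarith
    omega

end SlabCover

end Literature.MathematicalPhysics.QuantumLattice

end
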